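/-
Copyright: public-audit package `pub-balaban` (b2b-balaban), seat pv28-g10. Released under Apache 2.0 like Mathlib.
-/
import Literature.MathematicalPhysics.QuantumFieldTheory.Balaban1983to89.T4CubeChartTransport
import Literature.MathematicalPhysics.QuantumFieldTheory.Balaban1983to89.UnitaryModel
import Literature.MathematicalPhysics.QuantumFieldTheory.CircleHaarAngle

/-!
# T4 — the cube chart of the `U(1)` fibre: caveat (CHART) of `T4CubeChartTransport` in the abelian case

`Literature/MathematicalPhysics/QuantumFieldTheory/Balaban1983to89/`, namespace
`Literature.MathematicalPhysics.QuantumFieldTheory.Balaban1983to89.T4CubeChartCircle`.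
Row `T4-O3.E-iii-b-G7-BLWINDOW-CHART-U1*` of the pub-balaban cell (lineage pv28, gen 10; a kernel continuation of row
`T4-O3.E-iii-b-G7-BLWINDOW°`, gen 9, under the cell's row-id policy T4-DAG §8 Q24(a); cell records GAPS G-pv28g9-1 (ii),
`t4/T4-EST-O3Eiiib-G7.md` §2sexies).
Versions: v1 (§1–§5, p185440), v1.1 (same seat: + §6 «window mass», APPEND-ONLY — the declarations of §1–§5
byte-identical to v1).

## HONEST FRAMING

Nothing in this file is printed in Bałaban's papers and nothing is asserted about any of his densities, windows or
exponents.  It DISCHARGES, for the abelian structure group `G = U(1)` of the cell (`Matrix.unitaryGroup (Fin 1) ℂ` with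
the cell's instances `instGaugeGroupUnitaryGroup`, `instHaarDataUnitaryGroup` of `UnitaryModel` and the tree's Borel
structure `Matrix.unitaryGroup.instMeasurableSpace`), the change-of-variables HYPOTHESIS `CubeChart s χ u₀ n S φ jac` of
`T4CubeChartTransport` — its caveat (CHART), «`U(1)`: exact with `jac` constant», located there and typed here: for
every bond set `s`, reference field `u₀`, enumeration `e : s ≃ Fin n` and half-width `0 < S < π`, the windowed base law
`χ(u₀←y) · Haar^s(dy)` of the one-step fibre `(s → U(1))`, with `χ` = the PRODUCT ARC WINDOW
`∏_{b ∈ s} 1[U(b) ∈ {u₀(b) e^{iθ} : |θ| ≤ S}]`, IS the image under the POLAR CHART `x ↦ (u₀(b) e^{i x_{e b}})_{b ∈ s}`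
of the weighted cube law `e^{-jac} 1_{[-S,S]ⁿ} dx` with the CONSTANT log-Jacobian `jac ≡ n log(2π)`
(`cubeChart_unitaryOne`).  The one-dimensional input is the identification of the cell's Haar datum on `U(1)` with the
normalised angle measure, `(θ ↦ e^{iθ})_* ((2π)⁻¹ 1_{(-π,π]} dθ) = HaarData.haar` (`map_expU_angleMeasure`), transported
from the tree's `CircleHaar.map_exp_angleMeasure` (Mathlib's `Circle`) along the isomorphism `ofCircle : Circle →* U(1)`
by uniqueness of Haar measure (Mathlib's `haarMeasure_unique`, `isHaarMeasure_map_of_isFiniteMeasure`); left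
invariance and injectivity of the angle on the period window then give the Haar measure on an arc window
(`haar_restrict_arcWindow`), and `measurePreserving_pi` / `measurePreserving_piCongrLeft` assemble the fibre.

Consequence for the consumer `T4CubeChartTransport.mem_respDom_of_cubeChart` (the plug of the cube Brascamp–Lieb
engine into the (VAR) slots of the covariance response): in the `U(1)` case its chart hypothesis `hc` and its window
hypotheses `hχm`, `hχ0`, `hbl` are THEOREMS (`cubeChart_unitaryOne`, `measurable_windowDensity`,
`windowDensity_nonneg`, `windowDensity_blind`), and since `jac` is constant the convexity input `λ` of its caveat (γ) is
the convexity modulus on the cube of the transported exponent `x ↦ −h(u₀←φ x)` alone (i.e. the CONCAVITY modulus of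
`h∘φ`; no Jacobian term).  The non-abelian case (`SU(N)`, `N ≥ 2`: exponential coordinates, `e^{-jac}` = the
non-constant Haar density, a sup-norm Lie-algebra window) is NOT treated.

## CITATION HEADER

No page of Bałaban's papers was read for this file; every declaration is tagged [folklore] (the Haar measure of the
circle group in the angle parametrisation; push-forward, restriction and finite products of measures).
0 [cite], 0 [model].

## WHAT IS PROVED (CENSUS: 55 declarations — 1 abbreviation, 6 definitions, 1 instance, 47 theorems (§1–§5: 48 as in
v1; §6: 7 theorems); axioms {propext, Classical.choice, Quot.sound}; 0 sorry)

* §1 `U1`; `ofCircle : Circle →* U1` (`coe_ofCircle`, continuous, injective, surjective — `norm_entry_eq_one`: a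
  `1 × 1` unitary is `(z)`, `|z| = 1`); `expU θ = e^{iθ} ∈ U(1)` (`= ofCircle ∘ Circle.exp`, continuous,
  measurable, `expU 0 = 1`, injective on `(-π, π]`); `θ ↦ g e^{iθ}` continuous and measurable.
* §2 `secondCountableTopology_U1`; `haar_eq_haarMeasure` (`HaarData.haar = haarMeasure ⊤` on `U(1)`, `rfl`);
  `map_ofCircle_haarProbability`; `map_expU_angleMeasure : CircleHaar.angleMeasure.map expU = HaarData.haar`.
* §3 `arcWindow g S = {g e^{iθ} : |θ| ≤ S}` (compact, measurable, `∋ g`); `preimage_arcWindow_inter_Ioc` (on the period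
  window the angles landing in it are exactly `[-S, S]`, `S < π`); `arcMeasure S = (2π)⁻¹ 1_{[-S,S]} dθ` (finite);
  `angleMeasure_restrict_preimage_arcWindow`; `haar_restrict_arcWindow` / `measurePreserving_mul_expU`:
  `Haar|_{arcWindow g S} = (θ ↦ g e^{iθ})_* (arcMeasure S)` for `S < π`; `haar_arcWindow`: its Haar mass is `S/π`.
* §4 `cubeWeighted_const_eq_pi`: `cubeWeighted n S (n log 2π) = ⨂_{Fin n} arcMeasure S`.
* §5 `windowDensity s u₀ S` (measurable, `[0,1]`-valued, blind outside `s` (`windowDensity_congr`, `windowDensity_blind`),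
  `= 1` at `u₀`, the indicator of the box `∏_b arcWindow (u₀ b) S` on the fibre (`windowDensity_updateFinset`,
  `ofReal_windowDensity_updateFinset`, `fibreBase_withDensity_windowDensity`)); `polarChart s u₀ e`
  (`piCongrLeft_symm_apply`, `polarChart_eq_comp`, `measurePreserving_polarChart`); the instances `cubeChart_unitaryOne`
  (any `e : s ≃ Fin n`), `cubeChart_unitaryOne_card` (`n = |s|`, `e = s.equivFin`), `exists_cubeChart_unitaryOne`.
* §6 (v1.1) the WINDOW MASS: `fibreLaw_windowDensity` (`T4DressingDefect.fibreLaw` of the arc window at `u₀` = the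
  product of the restricted Haar data), `fibreLaw_windowDensity_univ` (`= (S/π)^{#s}` in `ℝ≥0∞`, `S < π`),
  `fibreIntegral_windowDensity` (`B15.BasicStep.fibreIntegral s χ u₀ = (S/π)^{#s}`, `0 ≤ S < π`),
  `fibreIntegral_windowDensity_pos` (`0 < S < π`); for a bounded exponent `|h| ≤ B`:
  `fibreIntegral_windowDensity_mul_exp_pos` / `…_ne_zero` — the window-mass proviso
  `fibreIntegral s (χ·e^{h}) u₀ ≠ 0` of `T4CovarianceResponse.meanLipschitz_of_varianceBound` (and of
  `T4CubeChartTransport` §4) DISCHARGED for the arc window (via `T4JointDressing.fibreIntegral_exp_dressed_pos`) — and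
  `windowDensity_mul_exp_le` (`χ·e^{h} ≤ e^{B}`, the consumers' binder `hC`).

## CAVEATS

* (HALF) `S < π`: at `S = π` the chart is still injective a.e. (the window is then the whole group) and for `S > π` the
  identity is FALSE (the chart covers twice); `0 < S` is demanded by `IsCubeImage` itself.
* (SHARP-WINDOW) `χ` is the `{0,1}`-valued product arc window — exactly the shape (CHART) asks for; a smooth cutoff is
  not of this shape (it would enter `jac`, then no longer constant), as recorded there.
* (NONABELIAN) Only `U(1)`; the `SU(N)` statement (Haar density of exponential coordinates on a sup-norm Lie-algebra
  window) is not typed here.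
* (EXT), (REAL), (γ) of `T4CubeChartTransport` are untouched: this file supplies the chart and the window, not the
  convexity modulus, the `C²` representatives on `ℝⁿ` or the insert gradients.
* Value = kernel certificate that the hypothesis class `CubeChart` of the Brascamp–Lieb transport is INHABITED by a
  genuine group fibre with the cell's own `HaarData` (beyond the Euclidean self-instance `isCubeImage_indicator`) — NOT
  summit progress.
-/

noncomputable section

open _root_.MeasureTheory Set
open Function (updateFinset)
open scoped ENNReal Real

namespace Literature.MathematicalPhysics.QuantumFieldTheory.Balaban1983to89.T4CubeChartCircle

open Literature.MathematicalPhysics.QuantumLattice (u1Rep u1Rep_apply u1Rep_mem_unitaryGroup continuous_u1Rep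
  u1Rep_injective)
open Literature.MathematicalPhysics.QuantumFieldTheory (haarProbability)
open T4TiltModulus T4CubePoincare T4CubeChartTransport

/-! ## §1  `U(1)` of the cell and its angle parametrisation `θ ↦ e^{iθ}` -/

/-- `U(1)` of the cell: the `1 × 1` complex unitary matrices `Matrix.unitaryGroup (Fin 1) ℂ`, carrying the cell's
instances `instGaugeGroupUnitaryGroup`, `instRegularGaugeGroupUnitaryGroup`, `instHaarDataUnitaryGroup` (`UnitaryModel`)
and the tree's Borel structure `Matrix.unitaryGroup.instMeasurableSpace`. [folklore] -/
abbrev U1 : Type := ↥(Matrix.unitaryGroup (Fin 1) ℂ)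

/-- The isomorphism `Circle →* U(1)`, `z ↦ (z)`: the tree's one-dimensional representation `u1Rep` with values in the
subgroup (`u1Rep_mem_unitaryGroup`). [folklore] -/
def ofCircle : Circle →* U1 :=
  u1Rep.codRestrict (Matrix.unitaryGroup (Fin 1) ℂ) u1Rep_mem_unitaryGroup

/-- The matrix of `ofCircle z` is `u1Rep z = (z)`. [folklore] -/
@[simp] theorem coe_ofCircle (z : Circle) : ((ofCircle z : U1) : Matrix (Fin 1) (Fin 1) ℂ) = u1Rep z := rfl

/-- `ofCircle` is continuous. [folklore] -/
theorem continuous_ofCircle : Continuous ofCircle :=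
  continuous_u1Rep.subtype_mk _

/-- `ofCircle` is injective. [folklore] -/
theorem ofCircle_injective : Function.Injective ofCircle := fun z w h =>
  u1Rep_injective (by simpa only [coe_ofCircle] using congrArg (fun U : U1 => (U : Matrix (Fin 1) (Fin 1) ℂ)) h)

/-- The entry of a `1 × 1` unitary matrix has norm one. [folklore] -/
theorem norm_entry_eq_one (U : U1) : ‖(U : Matrix (Fin 1) (Fin 1) ℂ) 0 0‖ = 1 := by
  have h := Matrix.mem_unitaryGroup_iff.1 U.2
  have h00 := congrArg (fun M : Matrix (Fin 1) (Fin 1) ℂ => M 0 0) h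
  simp only [Matrix.mul_apply, Fin.sum_univ_one, Matrix.star_eq_conjTranspose, Matrix.conjTranspose_apply,
    Matrix.one_apply_eq, Complex.star_def, Complex.mul_conj'] at h00
  have h1 : ‖(U : Matrix (Fin 1) (Fin 1) ℂ) 0 0‖ ^ 2 = 1 := by exact_mod_cast h00
  nlinarith [norm_nonneg ((U : Matrix (Fin 1) (Fin 1) ℂ) 0 0)]

/-- `ofCircle` is onto: a `1 × 1` unitary matrix is `(z)` with `|z| = 1`. [folklore] -/
theorem ofCircle_surjective : Function.Surjective ofCircle := fun U => by
  refine ⟨⟨(U : Matrix (Fin 1) (Fin 1) ℂ) 0 0, mem_sphere_zero_iff_norm.2 (norm_entry_eq_one U)⟩, ?_⟩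
  apply Subtype.ext
  ext i j
  obtain rfl : i = 0 := Subsingleton.elim _ _
  obtain rfl : j = 0 := Subsingleton.elim _ _
  simp [Matrix.scalar_apply]

/-- **The angle parametrisation** `θ ↦ e^{iθ} ∈ U(1)` (`= ofCircle ∘ Circle.exp`). [folklore] -/
def expU (θ : ℝ) : U1 := ofCircle (Circle.exp θ)

/-- `expU = ofCircle ∘ Circle.exp`. [folklore] -/
theorem expU_eq_comp : expU = ofCircle ∘ Circle.exp := rfl

/-- `e^{i0} = 1`. [folklore] -/
@[simp] theorem expU_zero : expU 0 = 1 := by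
  rw [expU, Circle.exp_zero, map_one]

/-- `θ ↦ e^{iθ}` is continuous. [folklore] -/
theorem continuous_expU : Continuous expU := continuous_ofCircle.comp Circle.exp.continuous

/-- `θ ↦ e^{iθ}` is measurable. [folklore] -/
theorem measurable_expU : Measurable expU := continuous_expU.measurable

/-- `θ ↦ e^{iθ}` is injective on the period window `(-π, π]`. [folklore] -/
theorem expU_injOn_Ioc : Set.InjOn expU (Ioc (-π) π) := fun _ ha _ hb h =>
  Circle.exp_injOn_Ioc (by linarith) ha hb (ofCircle_injective h)

/-- `θ ↦ g e^{iθ}` is continuous. [folklore] -/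
theorem continuous_mul_expU (g : U1) : Continuous fun θ : ℝ => g * expU θ :=
  continuous_const.mul continuous_expU

/-- `θ ↦ g e^{iθ}` is measurable. [folklore] -/
theorem measurable_mul_expU (g : U1) : Measurable fun θ : ℝ => g * expU θ := (continuous_mul_expU g).measurable

/-! ## §2  The cell's Haar datum on `U(1)` in angles -/

/-- `U(1)` is second countable (the `Matrix` synonym hides the instance; cf. `secondCountableTopology_matrix`). [folklore] -/
theorem secondCountableTopology_U1 : SecondCountableTopology U1 := by
  haveI := secondCountableTopology_matrix (n := Fin 1)
  exact Topology.IsEmbedding.subtypeVal.secondCountableTopology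

/-- The cell's Haar datum on `U(1)` (`instHaarDataUnitaryGroup = HaarData.ofCompactGroup _`) is Mathlib's normalised
Haar measure `haarMeasure ⊤`, definitionally. [folklore] -/
theorem haar_eq_haarMeasure : (HaarData.haar : Measure U1) = Measure.haarMeasure ⊤ := rfl

/-- The isomorphism `ofCircle` pushes the normalised Haar measure of `Circle` to the cell's Haar datum on `U(1)`
(a left-invariant probability measure; uniqueness of Haar measure). [folklore] -/
theorem map_ofCircle_haarProbability :
    (haarProbability Circle).map ofCircle = (HaarData.haar : Measure U1) := by
  haveI := secondCountableTopology_U1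
  haveI : IsProbabilityMeasure (haarProbability Circle) :=
    RepresentationTheory.CompactGroups.CompactGroup.isProbabilityMeasure_haarMeasure_top
  haveI : Measure.IsHaarMeasure (haarProbability Circle) := Measure.isHaarMeasure_haarMeasure ⊤
  haveI : Measure.IsHaarMeasure ((haarProbability Circle).map ofCircle) :=
    Measure.isHaarMeasure_map_of_isFiniteMeasure (haarProbability Circle) ofCircle continuous_ofCircle
      ofCircle_surjective
  rw [Measure.haarMeasure_unique ((haarProbability Circle).map ofCircle) ⊤, haar_eq_haarMeasure,
    TopologicalSpace.PositiveCompacts.coe_top, Measure.map_apply continuous_ofCircle.measurable MeasurableSet.univ,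
    Set.preimage_univ, measure_univ, one_smul]

/-- **The cell's Haar datum on `U(1)` in angles**: `θ ↦ e^{iθ}` pushes the normalised angle measure `(2π)⁻¹ dθ` on
`(-π, π]` (`CircleHaar.angleMeasure` of the tree) to `HaarData.haar`. [folklore] -/
theorem map_expU_angleMeasure : CircleHaar.angleMeasure.map expU = (HaarData.haar : Measure U1) := by
  rw [expU_eq_comp, ← Measure.map_map continuous_ofCircle.measurable Circle.exp.continuous.measurable,
    CircleHaar.map_exp_angleMeasure, map_ofCircle_haarProbability]

/-! ## §3  Arc windows and the Haar measure on them -/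

section Window

variable {g : U1} {S : ℝ}

/-- The ARC WINDOW of angular half-width `S` about `g ∈ U(1)`: `{g e^{iθ} : |θ| ≤ S}`. [folklore] -/
def arcWindow (g : U1) (S : ℝ) : Set U1 := (fun θ : ℝ => g * expU θ) '' Icc (-S) S

/-- The arc window is compact. [folklore] -/
theorem isCompact_arcWindow : IsCompact (arcWindow g S) := isCompact_Icc.image (continuous_mul_expU g)

/-- The arc window is measurable. [folklore] -/
theorem measurableSet_arcWindow : MeasurableSet (arcWindow g S) := isCompact_arcWindow.isClosed.measurableSet

/-- The centre lies in its window (`S ≥ 0`). [folklore] -/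
theorem mem_arcWindow_self (hS : 0 ≤ S) : g ∈ arcWindow g S :=
  ⟨0, ⟨by linarith, hS⟩, by simp⟩

/-- On the period window `(-π, π]` the angles landing in the arc window of half-width `S < π` are exactly `[-S, S]`.
[folklore] -/
theorem preimage_arcWindow_inter_Ioc (g : U1) (hSπ : S < π) :
    (fun θ : ℝ => g * expU θ) ⁻¹' arcWindow g S ∩ Ioc (-π) π = Icc (-S) S := by
  ext θ
  simp only [mem_inter_iff, mem_preimage, arcWindow, mem_image]
  constructor
  · rintro ⟨⟨θ', hθ', h⟩, hθ⟩
    have h' : expU θ' = expU θ := mul_left_cancel h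
    have hθ'' : θ' ∈ Ioc (-π) π := ⟨by linarith [hθ'.1], by linarith [hθ'.2]⟩
    rw [← expU_injOn_Ioc hθ'' hθ h']
    exact hθ'
  · intro hθ
    exact ⟨⟨θ, hθ, rfl⟩, by linarith [hθ.1], by linarith [hθ.2]⟩

/-- The NORMALISED ANGLE MEASURE `(2π)⁻¹ dθ` on the window `[-S, S]`. [folklore] -/
def arcMeasure (S : ℝ) : Measure ℝ := (ENNReal.ofReal (2 * π))⁻¹ • volume.restrict (Icc (-S) S)

/-- The normalised angle measure on a window is finite. [folklore] -/
instance isFiniteMeasure_arcMeasure (S : ℝ) : IsFiniteMeasure (arcMeasure S) :=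
  Measure.smul_finite _ (ENNReal.inv_ne_top.2 CircleHaar.ofReal_two_pi_ne_zero)

/-- Restricting the angle measure of the period window to the angles of an arc window of half-width `S < π` gives the
normalised angle measure on `[-S, S]`. [folklore] -/
theorem angleMeasure_restrict_preimage_arcWindow (g : U1) (hSπ : S < π) :
    CircleHaar.angleMeasure.restrict ((fun θ : ℝ => g * expU θ) ⁻¹' arcWindow g S) = arcMeasure S := by
  rw [CircleHaar.angleMeasure, Measure.restrict_smul,
    Measure.restrict_restrict (measurable_mul_expU g measurableSet_arcWindow),
    preimage_arcWindow_inter_Ioc g hSπ, arcMeasure]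

/-- **THE HAAR MEASURE ON AN ARC WINDOW IN ANGLES**: for `S < π`, the cell's Haar datum restricted to the arc window
`{g e^{iθ} : |θ| ≤ S}` is the image of `(2π)⁻¹ 1_{[-S,S]} dθ` under `θ ↦ g e^{iθ}` (left invariance + §2 + injectivity
of the angle on the period window). [folklore] -/
theorem haar_restrict_arcWindow (g : U1) (hSπ : S < π) :
    (HaarData.haar : Measure U1).restrict (arcWindow g S) = (arcMeasure S).map (fun θ : ℝ => g * expU θ) := by
  have hf := measurable_mul_expU g
  calc (HaarData.haar : Measure U1).restrict (arcWindow g S)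
      = (((HaarData.haar : Measure U1).map (fun h => g * h))).restrict (arcWindow g S) := by
        rw [HaarData.map_mul_left]
    _ = ((CircleHaar.angleMeasure.map expU).map (fun h => g * h)).restrict (arcWindow g S) := by
        rw [map_expU_angleMeasure]
    _ = (CircleHaar.angleMeasure.map (fun θ : ℝ => g * expU θ)).restrict (arcWindow g S) := by
        rw [Measure.map_map (continuous_const_mul g).measurable measurable_expU]; rfl
    _ = (CircleHaar.angleMeasure.restrict ((fun θ : ℝ => g * expU θ) ⁻¹' arcWindow g S)).map
          (fun θ : ℝ => g * expU θ) := Measure.restrict_map hf measurableSet_arcWindow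
    _ = (arcMeasure S).map (fun θ : ℝ => g * expU θ) := by rw [angleMeasure_restrict_preimage_arcWindow g hSπ]

/-- `θ ↦ g e^{iθ}` is measure preserving from the normalised angle measure on `[-S, S]` to the Haar datum on the arc
window (`S < π`). [folklore] -/
theorem measurePreserving_mul_expU (g : U1) (hSπ : S < π) :
    MeasurePreserving (fun θ : ℝ => g * expU θ) (arcMeasure S)
      ((HaarData.haar : Measure U1).restrict (arcWindow g S)) :=
  ⟨measurable_mul_expU g, (haar_restrict_arcWindow g hSπ).symm⟩

/-- The total Haar mass of an arc window of half-width `S < π` is `S/π` (`= 0` for `S ≤ 0`, where `ENNReal.ofReal`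
truncates). [folklore] -/
theorem haar_arcWindow (g : U1) (hSπ : S < π) :
    (HaarData.haar : Measure U1) (arcWindow g S) = ENNReal.ofReal (S / π) := by
  rw [← Measure.restrict_apply_univ, haar_restrict_arcWindow g hSπ,
    Measure.map_apply (measurable_mul_expU g) MeasurableSet.univ, Set.preimage_univ, arcMeasure, Measure.smul_apply,
    Measure.restrict_apply_univ, Real.volume_Icc, smul_eq_mul, show S - -S = 2 * S by ring,
    ← ENNReal.ofReal_inv_of_pos (by positivity : (0 : ℝ) < 2 * π), ← ENNReal.ofReal_mul (by positivity)]
  congr 1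
  field_simp

end Window

/-! ## §4  The weighted cube with constant Jacobian is the product of normalised angle measures -/

/-- With the CONSTANT log-Jacobian `jac ≡ n log(2π)` the weighted cube law `e^{-jac} 1_{[-S,S]ⁿ} dx` of
`T4CubeChartTransport.cubeWeighted` is the product of the normalised angle measures on `[-S, S]`. [folklore] -/
theorem cubeWeighted_const_eq_pi (n : ℕ) (S : ℝ) :
    cubeWeighted n S (fun _ => (n : ℝ) * Real.log (2 * π)) = Measure.pi fun _ : Fin n => arcMeasure S := by
  have h2 : (0 : ℝ) < 2 * π := by positivity
  have hc : ENNReal.ofReal (Real.exp (-((n : ℝ) * Real.log (2 * π)))) = (ENNReal.ofReal (2 * π))⁻¹ ^ n := by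
    rw [Real.exp_neg, ← Real.log_pow, Real.exp_log (pow_pos h2 n), ENNReal.ofReal_inv_of_pos (pow_pos h2 n),
      ENNReal.ofReal_pow h2.le, ENNReal.inv_pow]
  haveI : SigmaFinite ((ENNReal.ofReal (2 * π))⁻¹ • (volume : Measure ℝ).restrict (Icc (-S) S)) :=
    show SigmaFinite (arcMeasure S) from inferInstance
  have hfun : (fun x : Fin n → ℝ => ENNReal.ofReal (Real.exp (-(fun _ : Fin n → ℝ => (n : ℝ) * Real.log (2 * π)) x)))
      = fun _ => (ENNReal.ofReal (2 * π))⁻¹ ^ n := funext fun _ => hc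
  rw [cubeWeighted, hfun, withDensity_const, cube, volume_pi, Measure.restrict_pi_pi]
  simp only [arcMeasure]
  rw [CircleHaar.pi_const_smul, Fintype.card_fin]

/-! ## §5  The `U(1)` fibre: product arc window, polar chart, and the chart hypothesis -/

section Fibre

variable {P : Params} {j : ℕ}

/-- **THE PRODUCT ARC WINDOW** about the reference field `u₀` on the bonds of `s`, as a density:
`χ_{s,u₀,S}(U) = ∏_{b ∈ s} 1[U(b) ∈ arcWindow (u₀ b) S]` (`{0,1}`-valued, blind to the bonds outside `s`). [folklore] -/
def windowDensity (s : Finset (PBond P j)) (u₀ : GaugeField P j U1) (S : ℝ) : Density P j U1 :=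
  fun U => ∏ b ∈ s, (arcWindow (u₀ b) S).indicator (fun _ => (1 : ℝ)) (U b)

/-- **THE POLAR CHART** of the fibre through `s` about `u₀`, along an enumeration `e : s ≃ Fin n` of the bonds:
`x ↦ (b ↦ u₀(b) e^{i x_{e b}})`. [folklore] -/
def polarChart (s : Finset (PBond P j)) (u₀ : GaugeField P j U1) {n : ℕ} (e : s ≃ Fin n) :
    (Fin n → ℝ) → (s → U1) :=
  fun x b => u₀ b * expU (x (e b))

variable {s : Finset (PBond P j)} {u₀ : GaugeField P j U1} {S : ℝ} {n : ℕ}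

/-- The product arc window is measurable. [folklore] -/
theorem measurable_windowDensity (s : Finset (PBond P j)) (u₀ : GaugeField P j U1) (S : ℝ) :
    Measurable (windowDensity s u₀ S) := by
  refine Finset.measurable_prod s fun b _ => ?_
  exact (measurable_const.indicator measurableSet_arcWindow).comp (measurable_pi_apply (b : PBond P j))

/-- The product arc window is non-negative. [folklore] -/
theorem windowDensity_nonneg (U : GaugeField P j U1) : 0 ≤ windowDensity s u₀ S U :=
  Finset.prod_nonneg fun _ _ => Set.indicator_nonneg (fun _ _ => zero_le_one) _

/-- The product arc window takes values in `[0, 1]`. [folklore] -/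
theorem windowDensity_le_one (U : GaugeField P j U1) : windowDensity s u₀ S U ≤ 1 :=
  Finset.prod_le_one (fun _ _ => Set.indicator_nonneg (fun _ _ => zero_le_one) _)
    fun _ _ => Set.indicator_apply_le' (fun _ => le_rfl) (fun _ => zero_le_one)

/-- The product arc window is BLIND outside `s`: it does not see the bonds it does not constrain. [folklore] -/
theorem windowDensity_congr {U V : GaugeField P j U1} (h : ∀ b ∈ s, U b = V b) :
    windowDensity s u₀ S U = windowDensity s u₀ S V :=
  Finset.prod_congr rfl fun b hb => by rw [h b hb]

/-- The reference field lies in its window (`S ≥ 0`): `χ(u₀) = 1`. [folklore] -/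
theorem windowDensity_self (hS : 0 ≤ S) : windowDensity s u₀ S u₀ = 1 :=
  Finset.prod_eq_one fun _ _ => Set.indicator_of_mem (mem_arcWindow_self hS) _

/-- Relabelling coordinates along `e : s ≃ Fin n` (Mathlib's `MeasurableEquiv.piCongrLeft … e.symm`), evaluated.
[folklore] -/
theorem piCongrLeft_symm_apply (e : s ≃ Fin n) (x : Fin n → ℝ) (b : s) :
    MeasurableEquiv.piCongrLeft (fun _ : s => ℝ) e.symm x b = x (e b) := by
  have h := MeasurableEquiv.piCongrLeft_apply_apply (β := fun _ : s => ℝ) e.symm x (e b)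
  rwa [e.symm_apply_apply] at h

/-- The polar chart factors as the relabelling `ℝⁿ ≃ ℝ^s` followed by the coordinatewise charts `θ ↦ u₀(b) e^{iθ}`.
[folklore] -/
theorem polarChart_eq_comp (e : s ≃ Fin n) :
    polarChart s u₀ e =
      (fun (y : s → ℝ) (b : s) => u₀ b * expU (y b)) ∘ (MeasurableEquiv.piCongrLeft (fun _ : s => ℝ) e.symm) := by
  funext x
  funext b
  simp only [polarChart, Function.comp_apply, piCongrLeft_symm_apply]

/-- The polar chart is measure preserving from the product of the normalised angle measures on `[-S,S]ⁿ` to the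
product of the Haar data on the arc windows (`S < π`). [folklore] -/
theorem measurePreserving_polarChart (e : s ≃ Fin n) (hSπ : S < π) :
    MeasurePreserving (polarChart s u₀ e) (Measure.pi fun _ : Fin n => arcMeasure S)
      (Measure.pi fun b : s => (HaarData.haar : Measure U1).restrict (arcWindow (u₀ b) S)) := by
  rw [polarChart_eq_comp]
  exact (measurePreserving_pi (fun _ : s => arcMeasure S)
      (fun b : s => (HaarData.haar : Measure U1).restrict (arcWindow (u₀ b) S))
      fun b => measurePreserving_mul_expU (u₀ b) hSπ).comp
    (measurePreserving_piCongrLeft (fun _ : s => arcMeasure S) e.symm)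

variable [DecidableEq (PBond P j)]

/-- On the fibre through `s` at the exterior `u₀` the product arc window is the indicator of the box
`∏_{b ∈ s} arcWindow (u₀ b) S`. [folklore] -/
theorem windowDensity_updateFinset (y : s → U1) :
    windowDensity s u₀ S (updateFinset u₀ s y) =
      (Set.pi univ fun b : s => arcWindow (u₀ b) S).indicator (fun _ => (1 : ℝ)) y := by
  unfold windowDensity
  rw [← Finset.prod_coe_sort s]
  have hb : ∀ b : s, updateFinset u₀ s y (b : PBond P j) = y b := fun b => by
    simp [Function.updateFinset, b.2]
  simp_rw [hb]
  by_cases hy : y ∈ Set.pi univ fun b : s => arcWindow (u₀ b) S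
  · rw [indicator_of_mem hy]
    exact Finset.prod_eq_one fun b _ => indicator_of_mem (hy b (mem_univ _)) _
  · rw [indicator_of_notMem hy]
    simp only [mem_univ_pi, not_forall] at hy
    obtain ⟨b, hb'⟩ := hy
    exact Finset.prod_eq_zero (Finset.mem_univ b) (indicator_of_notMem hb' _)

/-- The product arc window is a BLIND WINDOW in the sense of `T4CovarianceResponse.respDom` /
`T4CubeChartTransport.mem_respDom_of_cubeChart` (hypothesis `hbl`): on the fibre through `s` its value does not depend
on the exterior. [folklore] -/
theorem windowDensity_blind (u : GaugeField P j U1) (y : s → U1) :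
    windowDensity s u₀ S (updateFinset u s y) = windowDensity s u₀ S (updateFinset u₀ s y) :=
  windowDensity_congr fun b hb => by simp [Function.updateFinset, hb]

/-- The same, for the `ℝ≥0∞`-valued weight of `IsCubeImage`. [folklore] -/
theorem ofReal_windowDensity_updateFinset :
    (fun y : s → U1 => ENNReal.ofReal (windowDensity s u₀ S (updateFinset u₀ s y))) =
      (Set.pi univ fun b : s => arcWindow (u₀ b) S).indicator 1 := by
  funext y
  rw [windowDensity_updateFinset]
  by_cases hy : y ∈ Set.pi univ fun b : s => arcWindow (u₀ b) S
  · rw [indicator_of_mem hy, indicator_of_mem hy, ENNReal.ofReal_one, Pi.one_apply]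
  · rw [indicator_of_notMem hy, indicator_of_notMem hy, ENNReal.ofReal_zero]

/-- The windowed base law of the `U(1)` fibre at the reference exterior is the product of the Haar data on the arc
windows. [folklore] -/
theorem fibreBase_withDensity_windowDensity :
    (fibreBase s).withDensity (fun y => ENNReal.ofReal (windowDensity s u₀ S (updateFinset u₀ s y))) =
      Measure.pi fun b : s => (HaarData.haar : Measure U1).restrict (arcWindow (u₀ b) S) := by
  rw [ofReal_windowDensity_updateFinset,
    withDensity_indicator_one (MeasurableSet.univ_pi fun _ => measurableSet_arcWindow)]
  exact Measure.restrict_pi_pi _ _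

/-- **THE CHART HYPOTHESIS HOLDS ON THE `U(1)` FIBRE** (caveat (CHART) of `T4CubeChartTransport`, abelian case):
for every bond set `s`, reference field `u₀`, enumeration `e : s ≃ Fin n` and half-width `0 < S < π`, the windowed base
law `χ_{s,u₀,S}(u₀←y) · Haar^s(dy)` of the fibre through `s` IS the image under the polar chart
`x ↦ (u₀(b) e^{i x_{e b}})_b` of the weighted cube law `e^{-jac} 1_{[-S,S]ⁿ} dx` with the CONSTANT log-Jacobian
`jac ≡ n log(2π)` — an instance of `CubeChart s χ u₀ n S φ jac` with `χ` = the product arc window. [folklore] -/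
theorem cubeChart_unitaryOne (s : Finset (PBond P j)) (u₀ : GaugeField P j U1) (e : s ≃ Fin n) (hS : 0 < S)
    (hSπ : S < π) :
    CubeChart s (windowDensity s u₀ S) u₀ n S (polarChart s u₀ e) (fun _ => (n : ℝ) * Real.log (2 * π)) where
  S_pos := hS
  measurable_w := (measurable_windowDensity s u₀ S).comp measurable_updateFinset
  nonneg_w _ := windowDensity_nonneg _
  measurable_φ := (measurePreserving_polarChart e hSπ).measurable
  measurable_jac := measurable_const
  map_eq := by
    rw [fibreBase_withDensity_windowDensity, cubeWeighted_const_eq_pi, (measurePreserving_polarChart e hSπ).map_eq]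

/-- The same with the canonical enumeration `s ≃ Fin s.card` (`n = |s|`). [folklore] -/
theorem cubeChart_unitaryOne_card (s : Finset (PBond P j)) (u₀ : GaugeField P j U1) (hS : 0 < S) (hSπ : S < π) :
    CubeChart s (windowDensity s u₀ S) u₀ s.card S (polarChart s u₀ s.equivFin)
      (fun _ => (s.card : ℝ) * Real.log (2 * π)) :=
  cubeChart_unitaryOne s u₀ s.equivFin hS hSπ

/-- NON-VACUITY of the hypothesis class `CubeChart` on a genuine group fibre: for every `s`, `u₀` and `0 < S < π` the
`U(1)` fibre admits a cube chart. [folklore] -/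
theorem exists_cubeChart_unitaryOne (s : Finset (PBond P j)) (u₀ : GaugeField P j U1) (hS : 0 < S) (hSπ : S < π) :
    ∃ (n : ℕ) (φ : (Fin n → ℝ) → (s → U1)) (jac : (Fin n → ℝ) → ℝ),
      CubeChart s (windowDensity s u₀ S) u₀ n S φ jac ∧ ∀ x, jac x = (n : ℝ) * Real.log (2 * π) :=
  ⟨s.card, _, _, cubeChart_unitaryOne_card s u₀ hS hSπ, fun _ => rfl⟩

end Fibre

/-! ## §6  (v1.1, APPEND-ONLY over v1 p185440: the declarations of §1–§5 unchanged) The window mass — the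
consumers' provisos `fibreIntegral … u₀ ≠ 0` and `χ·e^{h} ≤ C` for the arc window

The windowed fibre law at the reference exterior is the product of the Haar data restricted to the arc windows (§5), so
its total mass — the tree's restricted integral `B15.BasicStep.fibreIntegral s χ u₀` read through
`T4DressingDefect.toReal_fibreLaw_univ` — is `(S/π)^{#s}`, positive for `0 < S < π`; with a bounded exponent `|h| ≤ B`
the Gibbs data `χ·e^{h}` keeps a positive mass (`T4JointDressing.fibreIntegral_exp_dressed_pos`) and is bounded by
`e^{B}`.  These are the binders `hne` and `hC` of `T4CovarianceResponse.meanLipschitz_of_varianceBound` /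
`tiltData_fibre` (and of `T4CubeChartTransport` §4) for `G = U(1)`, `χ = windowDensity s u₀ S`. -/

section Mass

open T4DressingDefect T4JointDressing B15.BasicStep

variable {P : Params} {j : ℕ} [DecidableEq (PBond P j)]
variable {s : Finset (PBond P j)} {u₀ : GaugeField P j U1} {S : ℝ}

/-- The fibre law of the product arc window at the reference exterior is the product of the Haar data restricted to
the arc windows (`fibreBase_withDensity_windowDensity`, read through `T4DressingDefect.fibreLaw`). [folklore] -/
theorem fibreLaw_windowDensity :
    fibreLaw s (windowDensity s u₀ S) u₀ =
      Measure.pi fun b : s => (HaarData.haar : Measure U1).restrict (arcWindow (u₀ b) S) := by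
  rw [fibreLaw]
  exact fibreBase_withDensity_windowDensity

/-- THE WINDOW MASS in `ℝ≥0∞`: `(S/π)^{#s}` for `S < π`. [folklore] -/
theorem fibreLaw_windowDensity_univ (hSπ : S < π) :
    fibreLaw s (windowDensity s u₀ S) u₀ Set.univ = ENNReal.ofReal (S / π) ^ s.card := by
  rw [fibreLaw_windowDensity, Measure.pi_univ]
  simp_rw [Measure.restrict_apply_univ, haar_arcWindow _ hSπ]
  rw [Finset.prod_const, Finset.card_univ, Fintype.card_coe]

/-- **THE WINDOW MASS**: the tree's restricted integral `∫dV⌈_s χ_{s,u₀,S} (u₀) = (S/π)^{#s}` for `0 ≤ S < π`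
(`B15.BasicStep.fibreIntegral`). [folklore] -/
theorem fibreIntegral_windowDensity (hS : 0 ≤ S) (hSπ : S < π) :
    fibreIntegral s (windowDensity s u₀ S) u₀ = (S / π) ^ s.card := by
  rw [← toReal_fibreLaw_univ, fibreLaw_windowDensity_univ hSπ, ENNReal.toReal_pow,
    ENNReal.toReal_ofReal (div_nonneg hS Real.pi_pos.le)]

/-- … positive for `0 < S < π`. [folklore] -/
theorem fibreIntegral_windowDensity_pos (hS : 0 < S) (hSπ : S < π) :
    0 < fibreIntegral s (windowDensity s u₀ S) u₀ := by
  rw [fibreIntegral_windowDensity hS.le hSπ]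
  positivity

/-- **THE CONSUMER'S PROVISO FOR THE ARC WINDOW.**  For a bounded exponent `|h| ≤ B` the Gibbs data
`χ_{s,u₀,S}·e^{h}` has POSITIVE window mass at the reference exterior: `0 < ∫dV⌈_s (χ e^{h})(u₀)`
(`T4JointDressing.fibreIntegral_exp_dressed_pos` at `t = 1` over `fibreIntegral_windowDensity_pos`). [folklore] -/
theorem fibreIntegral_windowDensity_mul_exp_pos (hS : 0 < S) (hSπ : S < π) {h : Density P j U1} {B : ℝ}
    (hB : ∀ U, |h U| ≤ B) : 0 < fibreIntegral s (fun U => windowDensity s u₀ S U * Real.exp (h U)) u₀ := by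
  simpa only [one_mul] using fibreIntegral_exp_dressed_pos s h (fun U => windowDensity_nonneg U)
    (fun U => windowDensity_le_one U) hB 1 u₀ (fibreIntegral_windowDensity_pos hS hSπ).ne'

/-- … in the shape of the binder `hne : fibreIntegral s (fun U => χ U * Real.exp (h U)) u₀ ≠ 0` of
`T4CovarianceResponse.meanLipschitz_of_varianceBound` / `tiltData_fibre` and of `T4CubeChartTransport` §4. [folklore] -/
theorem fibreIntegral_windowDensity_mul_exp_ne_zero (hS : 0 < S) (hSπ : S < π) {h : Density P j U1} {B : ℝ}
    (hB : ∀ U, |h U| ≤ B) : fibreIntegral s (fun U => windowDensity s u₀ S U * Real.exp (h U)) u₀ ≠ 0 :=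
  (fibreIntegral_windowDensity_mul_exp_pos hS hSπ hB).ne'

omit [DecidableEq (PBond P j)] in
/-- The bound `χ e^{h} ≤ e^{B}` (binder `hC` of the consumers) for the arc window and `|h| ≤ B`. [folklore] -/
theorem windowDensity_mul_exp_le {h : Density P j U1} {B : ℝ} (hB : ∀ U, |h U| ≤ B) (U : GaugeField P j U1) :
    windowDensity s u₀ S U * Real.exp (h U) ≤ Real.exp B :=
  (mul_le_of_le_one_left (Real.exp_nonneg _) (windowDensity_le_one U)).trans
    (Real.exp_le_exp.2 (abs_le.1 (hB U)).2)

end Mass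

end Literature.MathematicalPhysics.QuantumFieldTheory.Balaban1983to89.T4CubeChartCircle
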